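import Summits.BirchSwinnertonDyer.Rank1Residual.Additive.RamifiedSevenGenusPartnerFP1
import Summits.BirchSwinnertonDyer.Rank1Residual.Additive.RamifiedSevenGenusIwasawaCharacterEvaluation
import Summits.BirchSwinnertonDyer.Rank1Residual.Additive.RamifiedSevenGenusKatoExpReadingValues
import Summits.BirchSwinnertonDyer.Rank1Residual.Additive.RamifiedSevenGenusKatoExpDatumOfLaws
import HarnessLib

set_option autoImplicit false

/-!
# `𝒞₇` genus road (crux `EllipticUnitValueSevenOfGZK`, K7r), row (K-2) of the (S-D-★′) recipe (pen D1141/D1149): KATO'S 7-ADIC ★-VALUE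
# LAW ON A PINNED FRAME FED BY A KUMMER COLUMN RECORD, from F-P1′ + (CMT-ℤ) + the two period facts — and the (S-D-★′) letter of
# zp v21 (`stub_katoExpUnitLawsSeven`) under exactly these four named facts

Cell bsd-cm, seat bsd-cm-k-ty1 g35 (literature-prover; explicit unit, claim-free); pen bsd-cm-plan g39 D1119 (R10)/D1120 (H)/D1124 (the letter),
D1141 (recipe), D1147–D1149 (F-P1′ and the (K-2) signature); critic idea-crit-15 g18 NOTEs #6/#13–#15, g19 NOTEs #22–#26.  PURE KERNEL
(theorems only): no named fact, no `sorry`, no `instance` declaration, no notation; everything landed is untouched.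

THE COMPUTATION (memo `FP1-CONSUMER-NOTE.md` §2–§3/§5 of k-ty1 g34, made kernel).  Fix a pinned frame `Φ` of a member `W` with a record
`D₃ : KummerColumnDataRat W Φ.Kcm … Φ.IK ι₀ Φ.𝔣 F.d Φ.φ` feeding its `ψ, Ω, 𝔏, euK` (at the frame of record these are `rfl`).  The previous file
(`RamifiedSevenGenusPartnerFP1`, (T5)+(T6)) delivers, at ONE realised family of `W` (from `hR`) with multiplier `M ≠ 0` and lift `y`:
(P) `(7^{a₁}M) • zOne = (u₁ 7^{a₂} 7^k) • y` (the frame's `zOne_pos`) and (F) at the rational twist `(β)`, `β = 42·7d + 1`: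
`(β 7^t M) • euK (β) = N(β) • C(e) • ((β − σ_{(β)}) • (C α₀ • w • res y + C α₁ • C(e) • φ_*(w • res y)))`.  Read both through the frame's
value functional `val := Φ.valOf ι₇ χ` at a character `χ` of level `7^{n+1}`, `ζ := χ(γK)⁻¹` primitive: `val (f • x) = ρ(f)·val x` with
`ρ = evalHom ι₇ ζ` a ring homomorphism ((K-1) `valOf_smul`, p823136), `val (σ_{(β)} • x) = ζ^m·val x` (`valOf_binomialSeries_smul`) and
`χ((β)) = ζ^{−m}` for the SAME `m` (`heckeIdealValue_eq_pow_of_isCoprime`), (eV) `val (euK (β)) = (N(β) − ψ((β))χ((β))⁻¹)·Ω⁻¹·Lf 1`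
(`valOf_euK`, p800949) with `ψ((β)) = β` (`ψ_conductor`), `N(β) = β²`, and (e2) `val (φ_* x) = ±ιC(√−7)·val x` (the record's (lin) through
`expStarCMShape_or_negSqrt` / `valOf_piK_of_expStarCM`; the sign is absorbed in `α₁`).  Then (F) reads
`β²(β − ζ^m)·7^t ρ(M) Ω⁻¹ Lf 1 = β²(β − ζ^m)·ι₇(e)·A·ρ(w)·V`, `A = ι₇α₀ + ι₇(eα₁)·μ`, `V = val (res y)`, and `β − ζ^m ≠ 0` (`β > 1`,
`ζ^{7^{n+1}} = 1`), whence (★★) `7^t ρ(M) Ω⁻¹ Lf 1 = ι₇(e) A ρ(w) V`; (P) reads `7^{a₁} ρ(M) V₁ = ρ(u₁) 7^{a₂+k} V`, `V₁ = val (res zOne)`;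
for `n ≥ n₀` ((M-CANCEL) `exists_level_forall_charEval_ne_zero`: `ρ(M) ≠ 0`) the two give, with `uStar := u₁·w⁻¹`, `γ = (eα₀, e²α₁)`,
`ν := γ₀² + 7γ₁² = ν_u·7^j` (`PadicInt.unitCoeff`; `ν ≠ 0` since `√−7 ∉ ℚ₇`, `eq_zero_of_add_mul_eq_zero_of_sq_eq_neg_seven`):
`7^{a₁ + j} · val (uStar⁻¹ • res zOne) = (ι₇ α₀′ + ι₇ α₁′ ιC(√−7)) Ω⁻¹ Lf 1`, `(α₀′, α₁′) = 7^{a₂+k+t} ν_u⁻¹ (γ₀, ∓γ₁) ≠ 0` — the `hZ` letter.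

## Contents
* §1 ★★ `PinnedKatoGenusFrame.unitLaws_of_FP1` — the `∃ (uStar, e′, α₀, α₁, n₀)` ★-value law on ANY pinned frame `Φ` fed by a record `D₃`
  (hypotheses `Φ.ψ = D₃.ψ`, `Φ.euK = D₃.euK`, `Φ.𝔏 = D₃.𝔏`, `Φ.sqrtNegSeven = s`, `Φ.𝔣 = (s)(d)`),
  CONDITIONAL on F-P1′, (CMT-ℤ), `nonempty_modularParametrizationData`, `IsNewformOf.level_eq_conductorNorm` and `hR`.
* §2 ★★★ `katoExpUnitLawsSeven_of_FP1 (hFP1) (hCMT) (hMP) (hLev) : <the ∀-letter of zp v21 `stub_katoExpUnitLawsSeven` l.891–934 VERBATIM>`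
  — §1 at the frame of record (`subst`; the five junctions are `rfl`).  CONSUMES (for the pen's closing touch): `hFP1 :
  CM.kato15161_ellipticUnitClass_res_zetaFamily_free`, `hCMT : CM.artin_natCast_smul_torsion`, `hMP : nonempty_modularParametrizationData`
  (in-file: `nonempty_modularParametrizationData_iff_exists_isNewformOf_unconditional.mpr fact_newform`), `hLev : ∀ {N} [NeZero N],
  IsNewformOf.level_eq_conductorNorm (N := N)`; of the stub's own binders only `hγ, hR, hι₀, s, D₃, ι₇` (and the frame) are used — `hstar,
  hGZK, h25, hM1, hM1′, h155u, hC, hbad, e, 𝔞, z, hη, d` enter only through `Φ = katoGenusFrameOfRecord …`.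

HONEST LABEL: kernel theorems CONDITIONAL on four displayed named facts (F-P1′ = Kato (15.16.1)/15.14/Thm. 12.5 (1) read after `⊗ ℚ`, net
debt +1 priced D1148; (CMT-ℤ) = CM reciprocity on torsion for rational moduli; the modular parametrisation and the level = conductor facts)
and on the stub's `hR`; the integrality of the constant (crux K2ᶜ proper) and the period position (S-★′) are NOT touched; this file closes NO
stub by itself (the pen's touch (11) applies §2 inside zp); stmt-BirchSwinnertonDyer-19945 stays OPEN (zp v21 bf8fc0bc14739463, 5 sorries);
`X12.CMRamifiedSeven` is NOT proved; no summit statement is proved by this seat; BSD is claimed for no curve.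

## References
* K. Kato, Astérisque 295 (2004): Thm. 12.5 (1) (p. 221), §13.9 and Lemma 13.10 (1) (p. 230), Prop. 15.9 (15.9.1) (pp. 258–259), (15.12.1)
  (p. 263), 15.14 (p. 264), (15.16.1) (p. 265). [Kato2004Asterisque]   L. Washington, *Cyclotomic Fields* (1997), Thm. 7.3, §13.1–13.2.
  [Washington1997]   D. Rohrlich (1984), Theorem 1 (context: non-vanishing; here replaced by the rational twist). [Rohrlich1984]
* Tree: (T5)+(T6) `Additive/RamifiedSevenGenusPartnerFP1.lean`; (K-1) `Additive/RamifiedSevenGenusIwasawaCharacterEvaluation.lean` (p823136);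
  `Additive/RamifiedSevenGenusKatoExpReading(Values).lean` (p800949); `Additive/RamifiedSevenGenusKatoExpDatumOfLaws.lean` (`negSqrt`);
  F-P1′ p825229; (CMT-ℤ) p821859; zp v21 `Cruxes/EllipticUnitValueSevenOfGZK/Lines/kato_perrin_riou_zp.lean` l.890–935.
-/

noncomputable section

open scoped NumberField TensorProduct
open WeierstrassCurve Field NumberField IsDedekindDomain
open Literature.NumberTheory.IwasawaTheory
open Literature.NumberTheory.GaloisRepresentations Literature.NumberTheory.GaloisRepresentations.LocalWeilDatum
open Literature.NumberTheory.EllipticCurves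
open Literature.NumberTheory.EllipticCurves.Rank1Residual
open Literature.NumberTheory.EllipticCurves.IwasawaAlgebra
open Literature.NumberTheory.EllipticCurves.Kato2004
open Literature.NumberTheory.EllipticCurves.ModularForms
open Literature.NumberTheory.ComplexMultiplication.EllipticUnits
open Summit.BirchSwinnertonDyer.Rank1Residual

namespace Summit.BirchSwinnertonDyer.Rank1Residual.Additive.GenusSeven

/-! ## §1 ★★ The ★-value law on a pinned frame fed by a record -/

section Frame

variable {W : WeierstrassCurve ℚ} [W.IsElliptic] [W.IsGloballyMinimal] [Fact (Nat.Prime 7)]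
  [ContinuousSMul ℤ_[7] (W.tateModule 7)] {K : ZpExtension ℚ 7} {hK : K.IsCyclotomic}
  {γ : Field.absoluteGaloisGroup ℚ} {I : IwasawaH1Data W 7 K γ}
  {F : GenusFrame} {θu : ∀ n : ℕ, globalUnitsOf (F.layer n)} {d : GenusDatum F θu}

set_option maxHeartbeats 4000000 in
/-- ★★ **KATO'S 7-ADIC ★-VALUE LAW ON A PINNED FRAME FED BY A KUMMER COLUMN RECORD** (module docstring «THE COMPUTATION»): for a pinned frame
`Φ` of `W` over `(K, hK, γ, I)` whose `ψ, Ω, 𝔏, euK, ιC, √−7, 𝔣` are those of a record `D₃ : KummerColumnDataRat W Φ.Kcm … Φ.IK ι₀ Φ.𝔣 F.d Φ.φ`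
(five equations, `rfl` at the frame of record), and a member carrying an admissible zeta class (`hR`): THERE ARE `uStar ∈ Λˣ`, `e′`,
`(α₀, α₁) ∈ ℤ₇² ∖ {0}`, `n₀` with, for every primitive layer character `χ` of level `7^{n+1}`, `n ≥ n₀`, and every continuation `Lf` of the
`7·7d`-depleted `L(ψ̄, χ, s)`: `7^{e′}·valOf ι₇ χ (uStar⁻¹ • res zOne) = (ι₇α₀ + ι₇α₁·ιC(√−7))·Ω⁻¹·Lf 1`.  CONDITIONAL on the displayed
named facts `hFP1` (F-P1′), `hCMT` ((CMT-ℤ)), `hMP`, `hLev`.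
[cite: Kato2004Asterisque, Thm. 12.5 (1) (p. 221), §13.9 and Lemma 13.10 (1) (p. 230), Prop. 15.9 (15.9.1) (pp. 258–259), 15.14 (p. 264), (15.16.1) (p. 265)]
[cite: Washington1997, Thm. 7.3 and §13.2] -/
theorem PinnedKatoGenusFrame.unitLaws_of_FP1
    (hFP1 : CM.kato15161_ellipticUnitClass_res_zetaFamily_free) (hCMT : CM.artin_natCast_smul_torsion)
    (hMP : nonempty_modularParametrizationData)
    (hLev : ∀ {N : ℕ} [NeZero N], IsNewformOf.level_eq_conductorNorm (N := N))
    (hγ : K.IsTopGenerator γ) (hR : ∃ z₀ : I.H, IsAdmissibleZetaClass W 7 K hK I z₀)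
    (Φ : PinnedKatoGenusFrame W K hK I d)
    (s : 𝓞 Φ.Kcm) (hs : Φ.sqrtNegSeven = (s : Φ.Kcm)) (h𝔣 : Φ.𝔣 = Ideal.span {s} * Ideal.span {((F.d : ℕ) : 𝓞 Φ.Kcm)})
    (ι₀ : Φ.Kcm →+* ℂ) (hι₀ : ∀ (w : InfinitePlace Φ.Kcm) (x : Φ.Kcm), ι₀ x = w.embedding x)
    (D₃ : KummerColumnDataRat W Φ.Kcm Φ.finrank_Kcm K Φ.IK ι₀ Φ.𝔣 F.d Φ.φ)
    (hψ : Φ.ψ = D₃.ψ) (heuK : Φ.euK = D₃.euK) (h𝔏 : Φ.𝔏 = D₃.𝔏) (ι₇ : ℚ_[7] →+* ℂ) :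
    ∃ (uStar : (IwasawaAlgebra 7)ˣ) (e' : ℕ) (α₀ α₁ : ℤ_[7]) (_ : α₀ ≠ 0 ∨ α₁ ≠ 0) (n₀ : ℕ),
      ∀ (n : ℕ), n₀ ≤ n → ∀ (χ : absoluteGaloisGroup Φ.Kcm →ₜ* ℂˣ),
        (∀ σ ∈ Φ.towerK.layerSubgroup (n + 1), χ σ = 1) →
        IsPrimitiveRoot (((χ Φ.γK : ℂˣ)) : ℂ) (7 ^ (n + 1)) →
        ∀ Lf : ℂ → ℂ, CM.IsDepletedHeckeL Φ.ψ χ (7 * (7 * F.d)) Lf →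
          (7 : ℂ) ^ e' * Φ.valOf ι₇ χ (uStar⁻¹ • I.resOver Φ.IK hγ Φ.isTopGenerator_γK Φ.zOne) =
            (ι₇ (α₀ : ℚ_[7]) + ι₇ (α₁ : ℚ_[7]) * Φ.ιC (algebraMap Φ.Kcm (AlgebraicClosure Φ.Kcm) Φ.sqrtNegSeven)) * Φ.Ω⁻¹ * Lf 1 := by
  classical
  have hs2 : ((s : Φ.Kcm)) ^ 2 = -7 := by rw [← hs]; exact Φ.sqrtNegSeven_sq
  have h𝔣dvd : Φ.𝔣 ∣ Ideal.span {((7 * F.d : ℕ) : 𝓞 Φ.Kcm)} := by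
    rw [h𝔣]
    exact span_sqrt_mul_span_natCast_dvd_span_seven_mul s hs2 F.d
  -- (T5)+(T6): the two class identities at ONE realised family of the member
  obtain ⟨M, hM, y, u₁, w, a₁, a₂, t, α₀, α₁, hα, hP, hF⟩ :=
    PartnerFP1.position_and_member_identity hFP1 hCMT hMP hLev K hK hγ I hR Φ.zOne_pos F.odd_d Φ.bad_iff_dvd Φ.Kcm
      Φ.finrank_Kcm s hs2 ι₀ hι₀ Φ.isTopGenerator_γK Φ.IK Φ.φ Φ.φ_sq h𝔣dvd D₃
  -- (e2) up to orientation, from the record's (lin)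
  obtain ⟨ε, hε, hE2⟩ : ∃ ε : ℤ, (ε = 1 ∨ ε = -1) ∧ ∀ (χ : absoluteGaloisGroup Φ.Kcm →ₜ* ℂˣ) (x : Φ.IK.H),
      Φ.valOf ι₇ χ (Φ.IK.isogenyMap Φ.φ Φ.IK Φ.isTopGenerator_γK x) =
        (ε : ℂ) * Φ.ιC (algebraMap Φ.Kcm (AlgebraicClosure Φ.Kcm) Φ.sqrtNegSeven) * Φ.valOf ι₇ χ x := by
    have hlin : ∀ (m : ℕ) (c : H1 (CM.tateRepK (W.baseChange Φ.Kcm) 7) (CM.torsionLayer (W.baseChange Φ.Kcm) (7 ^ m * (7 * F.d)))),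
        Φ.𝔏 (CM.torsionLayer (W.baseChange Φ.Kcm) (7 ^ m * (7 * F.d)))
            (isogenyLayerMapK 7 Φ.φ (CM.torsionLayer (W.baseChange Φ.Kcm) (7 ^ m * (7 * F.d))) c) =
          ((1 : ℚ_[7]) ⊗ₜ[ℤ] algebraMap Φ.Kcm (AlgebraicClosure Φ.Kcm) D₃.μ) *
            Φ.𝔏 (CM.torsionLayer (W.baseChange Φ.Kcm) (7 ^ m * (7 * F.d))) c := by
      rw [h𝔏]
      exact D₃.lin
    rcases Φ.expStarCMShape_or_negSqrt D₃.μ_sq hlin with h | h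
    · exact ⟨1, Or.inl rfl, fun χ x ↦ by rw [← Φ.piK_eq_isogenyMap, Φ.valOf_piK_of_expStarCM h, Int.cast_one, one_mul]⟩
    · refine ⟨-1, Or.inr rfl, fun χ x ↦ ?_⟩
      have h' : Φ.valOf ι₇ χ (Φ.piK x) = Φ.ιC (algebraMap Φ.Kcm (AlgebraicClosure Φ.Kcm) (-Φ.sqrtNegSeven)) * Φ.valOf ι₇ χ x :=
        Φ.negSqrt.valOf_piK_of_expStarCM h ι₇ χ x
      rw [map_neg, map_neg] at h'
      rw [← Φ.piK_eq_isogenyMap, Int.cast_neg, Int.cast_one, neg_one_mul]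
      exact h'
  -- the threshold: Kato's multiplier does not vanish at primitive characters of large level ((M-CANCEL), Weierstrass preparation)
  obtain ⟨n₀, hn₀⟩ := Φ.exists_level_forall_charEval_ne_zero ι₇ hM
  -- the constants
  have hμC2 : ((ε : ℂ) * Φ.ιC (algebraMap Φ.Kcm (AlgebraicClosure Φ.Kcm) Φ.sqrtNegSeven)) ^ 2 = -7 := by
    have hε2 : (ε : ℂ) ^ 2 = 1 := by rcases hε with rfl | rfl <;> norm_num
    rw [mul_pow, hε2, one_mul, ← map_pow, ← map_pow, Φ.sqrtNegSeven_sq, map_neg, map_ofNat, map_neg, map_ofNat]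
  have huD : (D₃.u : ℤ_[7]) ≠ 0 := Units.ne_zero _
  have hγ01 : (D₃.u : ℤ_[7]) * α₀ ≠ 0 ∨ (D₃.u : ℤ_[7]) ^ 2 * α₁ ≠ 0 :=
    hα.imp (fun h ↦ mul_ne_zero huD h) (fun h ↦ mul_ne_zero (pow_ne_zero _ huD) h)
  have hA0 : ι₇ (((D₃.u : ℤ_[7]) * α₀ : ℤ_[7]) : ℚ_[7]) +
      ι₇ (((D₃.u : ℤ_[7]) ^ 2 * α₁ : ℤ_[7]) : ℚ_[7]) * ((ε : ℂ) * Φ.ιC (algebraMap Φ.Kcm (AlgebraicClosure Φ.Kcm) Φ.sqrtNegSeven)) ≠ 0 :=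
    fun h0 ↦ by
    obtain ⟨h1, h2⟩ := CharacterEvaluation.eq_zero_of_add_mul_eq_zero_of_sq_eq_neg_seven ι₇ hμC2 h0
    rcases hγ01 with h | h
    · exact h (PadicInt.coe_eq_zero.mp h1)
    · exact h (PadicInt.coe_eq_zero.mp h2)
  have hB0 : ι₇ (((D₃.u : ℤ_[7]) * α₀ : ℤ_[7]) : ℚ_[7]) -
      ι₇ (((D₃.u : ℤ_[7]) ^ 2 * α₁ : ℤ_[7]) : ℚ_[7]) * ((ε : ℂ) * Φ.ιC (algebraMap Φ.Kcm (AlgebraicClosure Φ.Kcm) Φ.sqrtNegSeven)) ≠ 0 :=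
    fun h0 ↦ by
    have h0' : ι₇ (((D₃.u : ℤ_[7]) * α₀ : ℤ_[7]) : ℚ_[7]) + ι₇ ((-((D₃.u : ℤ_[7]) ^ 2 * α₁) : ℤ_[7]) : ℚ_[7]) *
        ((ε : ℂ) * Φ.ιC (algebraMap Φ.Kcm (AlgebraicClosure Φ.Kcm) Φ.sqrtNegSeven)) = 0 := by
      rw [PadicInt.coe_neg, map_neg, neg_mul, ← sub_eq_add_neg]
      exact h0
    obtain ⟨h1, h2⟩ := CharacterEvaluation.eq_zero_of_add_mul_eq_zero_of_sq_eq_neg_seven ι₇ hμC2 h0'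
    rcases hγ01 with h | h
    · exact h (PadicInt.coe_eq_zero.mp h1)
    · rw [PadicInt.coe_neg, neg_eq_zero] at h2
      exact h (PadicInt.coe_eq_zero.mp h2)
  have hAB : (ι₇ (((D₃.u : ℤ_[7]) * α₀ : ℤ_[7]) : ℚ_[7]) +
        ι₇ (((D₃.u : ℤ_[7]) ^ 2 * α₁ : ℤ_[7]) : ℚ_[7]) * ((ε : ℂ) * Φ.ιC (algebraMap Φ.Kcm (AlgebraicClosure Φ.Kcm) Φ.sqrtNegSeven))) *
      (ι₇ (((D₃.u : ℤ_[7]) * α₀ : ℤ_[7]) : ℚ_[7]) -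
        ι₇ (((D₃.u : ℤ_[7]) ^ 2 * α₁ : ℤ_[7]) : ℚ_[7]) * ((ε : ℂ) * Φ.ιC (algebraMap Φ.Kcm (AlgebraicClosure Φ.Kcm) Φ.sqrtNegSeven))) =
      ι₇ ((((D₃.u : ℤ_[7]) * α₀) ^ 2 + 7 * ((D₃.u : ℤ_[7]) ^ 2 * α₁) ^ 2 : ℤ_[7]) : ℚ_[7]) := by
    have h7 : ι₇ ((7 : ℤ_[7]) : ℚ_[7]) = 7 := by rw [show ((7 : ℤ_[7]) : ℚ_[7]) = 7 from rfl, map_ofNat]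
    simp only [PadicInt.coe_add, PadicInt.coe_mul, PadicInt.coe_pow, map_add, map_mul, map_pow, h7]
    linear_combination (-(ι₇ ((D₃.u : ℤ_[7]) : ℚ_[7]) ^ 4 * ι₇ ((α₁ : ℤ_[7]) : ℚ_[7]) ^ 2)) * hμC2
  have hν0 : ((D₃.u : ℤ_[7]) * α₀) ^ 2 + 7 * ((D₃.u : ℤ_[7]) ^ 2 * α₁) ^ 2 ≠ 0 := fun h0 ↦ by
    have h1 : ι₇ ((((D₃.u : ℤ_[7]) * α₀) ^ 2 + 7 * ((D₃.u : ℤ_[7]) ^ 2 * α₁) ^ 2 : ℤ_[7]) : ℚ_[7]) = 0 := by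
      rw [h0, PadicInt.coe_zero, map_zero]
    rw [← hAB, mul_eq_zero] at h1
    exact h1.elim hA0 hB0
  have hνfac := PadicInt.unitCoeff_spec hν0
  -- the witnesses
  refine ⟨u₁ * w⁻¹, a₁ + (((D₃.u : ℤ_[7]) * α₀) ^ 2 + 7 * ((D₃.u : ℤ_[7]) ^ 2 * α₁) ^ 2).valuation,
    ((7 ^ (a₂ + Φ.k + t) : ℕ) : ℤ_[7]) * ((PadicInt.unitCoeff hν0)⁻¹ : ℤ_[7]ˣ) * ((D₃.u : ℤ_[7]) * α₀),
    -(ε : ℤ_[7]) * (((7 ^ (a₂ + Φ.k + t) : ℕ) : ℤ_[7]) * ((PadicInt.unitCoeff hν0)⁻¹ : ℤ_[7]ˣ) * ((D₃.u : ℤ_[7]) ^ 2 * α₁)),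
    ?_, n₀, fun n hn χ hχ hprim Lf hLf ↦ ?_⟩
  · -- `(α₀′, α₁′) ≠ 0`
    have h7 : ((7 ^ (a₂ + Φ.k + t) : ℕ) : ℤ_[7]) ≠ 0 := by exact_mod_cast pow_ne_zero _ (by norm_num : (7 : ℕ) ≠ 0)
    have hνu : (((PadicInt.unitCoeff hν0)⁻¹ : ℤ_[7]ˣ) : ℤ_[7]) ≠ 0 := Units.ne_zero _
    have hε0 : (ε : ℤ_[7]) ≠ 0 := by rcases hε with rfl | rfl <;> simp
    rcases hγ01 with h | h
    · exact Or.inl (mul_ne_zero (mul_ne_zero h7 hνu) h)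
    · exact Or.inr (mul_ne_zero (neg_ne_zero.mpr hε0) (mul_ne_zero (mul_ne_zero h7 hνu) h))
  -- THE LAW at `χ`.  First the rational twist `β = 42·(7d) + 1` and its bookkeeping
  have hζN := Φ.inv_chi_γK_pow_eq_one χ hχ
  have h7 : ι₇ ((7 : ℤ_[7]) : ℚ_[7]) = 7 := by rw [show ((7 : ℤ_[7]) : ℚ_[7]) = 7 from rfl, map_ofNat]
  have hιu : ι₇ ((D₃.u : ℤ_[7]) : ℚ_[7]) ≠ 0 := by
    rw [map_ne_zero]
    exact PadicInt.coe_ne_zero.mpr huD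
  have hd0 : F.d ≠ 0 := by
    intro h0
    exact (Nat.not_odd_iff_even.mpr (by rw [h0]; decide)) F.odd_d
  set β : ℕ := 6 * 7 * (7 * F.d) + 1 with hβdef
  have hβ : 1 < β := by omega
  have hβc : β.Coprime (6 * 7 * (7 * F.d)) := Nat.coprime_self_add_left.mpr (Nat.coprime_one_left _)
  have hβf : ((7 * F.d : ℕ) : 𝓞 Φ.Kcm) ∣ ((β : ℕ) : 𝓞 Φ.Kcm) - 1 := ⟨((6 * 7 : ℕ) : 𝓞 Φ.Kcm), by rw [hβdef]; push_cast; ring⟩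
  have hTw : IsTwist 7 Φ.𝔣 (Ideal.span {((β : ℕ) : 𝓞 Φ.Kcm)}) := PartnerFP1.isTwist_span_natCast Φ.finrank_Kcm h𝔣dvd hβ hβc
  have hN𝔟 : Ideal.absNorm (Ideal.span {((β : ℕ) : 𝓞 Φ.Kcm)}) = β ^ 2 := absNorm_span_natCast Φ.finrank_Kcm β
  have hβ0 : ((β : ℕ) : 𝓞 Φ.Kcm) ≠ 0 := by exact_mod_cast (show β ≠ 0 by omega)
  have hψβ : CM.heckeCharIdealValue Φ.ψ (Ideal.span {((β : ℕ) : 𝓞 Φ.Kcm)}) = (β : ℂ) := by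
    rw [hψ, D₃.ψ_conductor _ hβ0 hβf, algClosureEmb_algebraMap]
    simp
  -- `χ((β)) = ζ^{−m}` and `σ_{(β)}` acts by `ζ^m`, for the SAME `m`
  set m : ℕ := (PadicInt.toZModPow (n + 1)
    (ZpExtension.artinExponent (K.restrictOfFinrankEqTwo (by decide) Φ.Kcm Φ.finrank_Kcm) (Ideal.span {((β : ℕ) : 𝓞 Φ.Kcm)}))).val
    with hmdef
  have ham : PadicInt.toZModPow (n + 1)
      (ZpExtension.artinExponent (K.restrictOfFinrankEqTwo (by decide) Φ.Kcm Φ.finrank_Kcm) (Ideal.span {((β : ℕ) : 𝓞 Φ.Kcm)})) =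
        (m : ZMod (7 ^ (n + 1))) := by
    haveI : NeZero (7 ^ (n + 1)) := ⟨pow_ne_zero _ (by norm_num)⟩
    rw [hmdef, ZMod.natCast_zmod_val]
  have h𝔟0 : Ideal.span {((β : ℕ) : 𝓞 Φ.Kcm)} ≠ ⊥ := by
    rw [Ne, Ideal.span_singleton_eq_bot]
    exact hβ0
  have h𝔟7 : IsCoprime (Ideal.span {((β : ℕ) : 𝓞 Φ.Kcm)}) (Ideal.span {((7 : ℕ) : 𝓞 Φ.Kcm)}) :=
    (Ideal.isCoprime_span_singleton_iff _ _).mpr (Nat.Coprime.cast (hβc.coprime_dvd_right ⟨6 * (7 * F.d), by ring⟩))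
  have hχβ : heckeIdealValue χ (Ideal.span {((β : ℕ) : 𝓞 Φ.Kcm)}) = (((χ Φ.γK : ℂˣ)) : ℂ) ^ m :=
    ZpExtension.heckeIdealValue_eq_pow_of_isCoprime _ Φ.isTopGenerator_γK χ hχ h𝔟0 h𝔟7 ham
  have hζinv : ((((χ Φ.γK : ℂˣ)) : ℂ) ^ m)⁻¹ = ((((χ Φ.γK)⁻¹ : ℂˣ)) : ℂ) ^ m := by
    rw [Units.val_inv_eq_inv_val, inv_pow]
  have hβC0 : (β : ℂ) ≠ 0 := by exact_mod_cast (show β ≠ 0 by omega)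
  have hβζ : (β : ℂ) - ((((χ Φ.γK)⁻¹ : ℂˣ)) : ℂ) ^ m ≠ 0 := by
    intro h0
    have h1 : ((β ^ 7 ^ (n + 1) : ℕ) : ℂ) = 1 := by
      rw [Nat.cast_pow, sub_eq_zero.mp h0, ← pow_mul, mul_comm, pow_mul, hζN, one_pow]
    have h2 : β ^ 7 ^ (n + 1) = 1 := by exact_mod_cast h1
    have h3 : β = 1 :=
      Nat.pow_left_injective (n := 7 ^ (n + 1)) (pow_ne_zero _ (by norm_num)) (show β ^ 7 ^ (n + 1) = 1 ^ 7 ^ (n + 1) by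
        rw [one_pow]; exact h2)
    omega
  -- (F) at `(β)`, read through `valOf`
  have hFβ := hF β hβ hβc hβf
  rw [← heuK] at hFβ
  have hFv := congrArg (Φ.valOf ι₇ χ) hFβ
  rw [Φ.valOf_smul ι₇ χ hχ ((((β : ℕ) : ℤ) : IwasawaAlgebra 7) * (((7 : ℕ) : IwasawaAlgebra 7) ^ t * M)),
    Φ.valOf_euK ι₇ _ hTw (n + 1) χ hχ Lf hLf, hψβ, hχβ, hζinv,
    Φ.valOf_smul ι₇ χ hχ (((Ideal.absNorm (Ideal.span {((β : ℕ) : 𝓞 Φ.Kcm)}) : ℕ) : IwasawaAlgebra 7)),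
    Φ.valOf_C_smul, sub_smul, map_sub, Φ.valOf_smul ι₇ χ hχ ((((β : ℕ) : ℤ)) : IwasawaAlgebra 7),
    Φ.valOf_binomialSeries_smul ι₇ χ hχ ham, map_add, Φ.valOf_C_smul, Φ.valOf_C_smul, Φ.valOf_C_smul, hE2,
    Φ.valOf_smul ι₇ χ hχ (w : IwasawaAlgebra 7), hN𝔟] at hFv
  simp only [map_mul, map_pow, map_natCast, map_ofNat, Int.cast_natCast, Nat.cast_pow, Nat.cast_ofNat] at hFv
  -- (P), read through `valOf` after `res`
  have hPv := congrArg (Φ.valOf ι₇ χ) (congrArg (I.resOver Φ.IK hγ Φ.isTopGenerator_γK) hP)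
  simp only [map_smul] at hPv
  rw [Φ.valOf_smul ι₇ χ hχ, Φ.valOf_smul ι₇ χ hχ] at hPv
  simp only [map_mul, map_pow, map_ofNat, Nat.cast_ofNat] at hPv
  -- the unit `uStar = u₁·w⁻¹` read
  rw [Φ.valOf_units_inv_smul ι₇ χ hχ, Units.val_mul, map_mul, map_units_inv]
  -- notation (the evaluation character `ρ`, the CM scalar `μC = ±ιC(√−7)`, the two values `V, V₁`)
  set ρ := CharacterEvaluation.evalHom ι₇ ((((χ Φ.γK)⁻¹ : ℂˣ)) : ℂ) ⟨n + 1, Φ.inv_chi_γK_pow_eq_one χ hχ⟩ with hρ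
  set μC : ℂ := (ε : ℂ) * Φ.ιC (algebraMap Φ.Kcm (AlgebraicClosure Φ.Kcm) Φ.sqrtNegSeven) with hμC
  set V : ℂ := Φ.valOf ι₇ χ (I.resOver Φ.IK hγ Φ.isTopGenerator_γK y) with hV
  set V₁ : ℂ := Φ.valOf ι₇ χ (I.resOver Φ.IK hγ Φ.isTopGenerator_γK Φ.zOne) with hV₁
  have hρM : ρ M ≠ 0 := by
    have h := hn₀ n hn χ hprim
    rwa [CharacterEvaluation.charEval_eq_evalHom ι₇ (Φ.inv_chi_γK_pow_eq_one χ hχ)] at h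
  have hρu₁ : ρ u₁ ≠ 0 := CharacterEvaluation.evalHom_units_ne_zero ι₇ _ _ u₁
  have hρw : ρ w ≠ 0 := CharacterEvaluation.evalHom_units_ne_zero ι₇ _ _ w
  -- (★★) after cancelling `β²(β − ζ^m) ≠ 0`
  have hFF : (7 : ℂ) ^ t * ρ M * Φ.Ω⁻¹ * Lf 1 =
      (ι₇ (((D₃.u : ℤ_[7]) * α₀ : ℤ_[7]) : ℚ_[7]) + ι₇ (((D₃.u : ℤ_[7]) ^ 2 * α₁ : ℤ_[7]) : ℚ_[7]) * μC) * ρ w * V := by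
    have h3 : ((β : ℂ) ^ 2 * ((β : ℂ) - ((((χ Φ.γK)⁻¹ : ℂˣ)) : ℂ) ^ m)) * ((7 : ℂ) ^ t * ρ M * Φ.Ω⁻¹ * Lf 1) =
        ((β : ℂ) ^ 2 * ((β : ℂ) - ((((χ Φ.γK)⁻¹ : ℂˣ)) : ℂ) ^ m)) *
          ((ι₇ (((D₃.u : ℤ_[7]) * α₀ : ℤ_[7]) : ℚ_[7]) + ι₇ (((D₃.u : ℤ_[7]) ^ 2 * α₁ : ℤ_[7]) : ℚ_[7]) * μC) * ρ w * V) := by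
      simp only [PadicInt.coe_mul, PadicInt.coe_pow, map_mul, map_pow]
      linear_combination hFv
    exact mul_left_cancel₀ (mul_ne_zero (pow_ne_zero _ hβC0) hβζ) h3
  -- `ν = ν_u · 7^j` read in `ℂ`, and the inverse of `ι₇ ν_u`
  have hνC : ι₇ ((((D₃.u : ℤ_[7]) * α₀) ^ 2 + 7 * ((D₃.u : ℤ_[7]) ^ 2 * α₁) ^ 2 : ℤ_[7]) : ℚ_[7]) =
      ι₇ ((PadicInt.unitCoeff hν0 : ℤ_[7]) : ℚ_[7]) *
        (7 : ℂ) ^ (((D₃.u : ℤ_[7]) * α₀) ^ 2 + 7 * ((D₃.u : ℤ_[7]) ^ 2 * α₁) ^ 2).valuation := by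
    conv_lhs => rw [hνfac]
    simp only [PadicInt.coe_mul, PadicInt.coe_pow, map_mul, map_pow, Nat.cast_ofNat, h7]
  have hιnu : ι₇ ((PadicInt.unitCoeff hν0 : ℤ_[7]) : ℚ_[7]) ≠ 0 := by
    rw [map_ne_zero]
    exact PadicInt.coe_ne_zero.mpr (Units.ne_zero _)
  have hιnuinv : ι₇ ((((PadicInt.unitCoeff hν0)⁻¹ : ℤ_[7]ˣ) : ℤ_[7]) : ℚ_[7]) = (ι₇ ((PadicInt.unitCoeff hν0 : ℤ_[7]) : ℚ_[7]))⁻¹ :=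
    (inv_eq_of_mul_eq_one_left (by rw [← map_mul, ← PadicInt.coe_mul, Units.inv_mul, PadicInt.coe_one, map_one])).symm
  -- step 3: `7^{a₁} · val · A = 7^{a₂+k+t} · Ω⁻¹ · Lf 1`
  have step3 : (7 : ℂ) ^ a₁ * ((ρ ↑u₁ * (ρ ↑w)⁻¹)⁻¹ * V₁) *
      (ι₇ (((D₃.u : ℤ_[7]) * α₀ : ℤ_[7]) : ℚ_[7]) + ι₇ (((D₃.u : ℤ_[7]) ^ 2 * α₁ : ℤ_[7]) : ℚ_[7]) * μC) =
      (7 : ℂ) ^ (a₂ + Φ.k + t) * Φ.Ω⁻¹ * Lf 1 := by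
    calc (7 : ℂ) ^ a₁ * ((ρ ↑u₁ * (ρ ↑w)⁻¹)⁻¹ * V₁) *
          (ι₇ (((D₃.u : ℤ_[7]) * α₀ : ℤ_[7]) : ℚ_[7]) + ι₇ (((D₃.u : ℤ_[7]) ^ 2 * α₁ : ℤ_[7]) : ℚ_[7]) * μC)
        = (ρ ↑u₁)⁻¹ * ((7 : ℂ) ^ a₁ * ρ M * V₁) * (ρ M)⁻¹ *
            ((ι₇ (((D₃.u : ℤ_[7]) * α₀ : ℤ_[7]) : ℚ_[7]) + ι₇ (((D₃.u : ℤ_[7]) ^ 2 * α₁ : ℤ_[7]) : ℚ_[7]) * μC) * ρ ↑w) := by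
          field_simp
      _ = (ρ ↑u₁)⁻¹ * (ρ ↑u₁ * (7 : ℂ) ^ a₂ * (7 : ℂ) ^ Φ.k * V) * (ρ M)⁻¹ *
            ((ι₇ (((D₃.u : ℤ_[7]) * α₀ : ℤ_[7]) : ℚ_[7]) + ι₇ (((D₃.u : ℤ_[7]) ^ 2 * α₁ : ℤ_[7]) : ℚ_[7]) * μC) * ρ ↑w) := by
          rw [hPv]
      _ = (7 : ℂ) ^ a₂ * (7 : ℂ) ^ Φ.k * (ρ M)⁻¹ *
            ((ι₇ (((D₃.u : ℤ_[7]) * α₀ : ℤ_[7]) : ℚ_[7]) + ι₇ (((D₃.u : ℤ_[7]) ^ 2 * α₁ : ℤ_[7]) : ℚ_[7]) * μC) * ρ ↑w * V) := by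
          field_simp
      _ = (7 : ℂ) ^ a₂ * (7 : ℂ) ^ Φ.k * (ρ M)⁻¹ * ((7 : ℂ) ^ t * ρ M * Φ.Ω⁻¹ * Lf 1) := by rw [hFF]
      _ = (7 : ℂ) ^ (a₂ + Φ.k + t) * Φ.Ω⁻¹ * Lf 1 := by
          field_simp
          ring
  -- step 4: multiply by the conjugate (`A·Ā = ι₇ ν = ι₇ ν_u · 7^j`) and divide by `ι₇ ν_u`
  have step4 := congrArg (· * (ι₇ (((D₃.u : ℤ_[7]) * α₀ : ℤ_[7]) : ℚ_[7]) -
    ι₇ (((D₃.u : ℤ_[7]) ^ 2 * α₁ : ℤ_[7]) : ℚ_[7]) * μC)) step3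
  rw [mul_assoc _ (ι₇ _ + _) (ι₇ _ - _), hAB, hνC] at step4
  calc (7 : ℂ) ^ (a₁ + (((D₃.u : ℤ_[7]) * α₀) ^ 2 + 7 * ((D₃.u : ℤ_[7]) ^ 2 * α₁) ^ 2).valuation) *
        ((ρ ↑u₁ * (ρ ↑w)⁻¹)⁻¹ * V₁)
      = (7 : ℂ) ^ (a₂ + Φ.k + t) * Φ.Ω⁻¹ * Lf 1 *
          (ι₇ (((D₃.u : ℤ_[7]) * α₀ : ℤ_[7]) : ℚ_[7]) - ι₇ (((D₃.u : ℤ_[7]) ^ 2 * α₁ : ℤ_[7]) : ℚ_[7]) * μC) *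
            (ι₇ ((PadicInt.unitCoeff hν0 : ℤ_[7]) : ℚ_[7]))⁻¹ := by
        rw [← step4]
        field_simp
        ring
    _ = _ := by
        rw [hμC]
        simp only [PadicInt.coe_mul, PadicInt.coe_pow, PadicInt.coe_neg, PadicInt.coe_intCast, map_mul, map_pow, map_neg,
          map_intCast, Nat.cast_pow, Nat.cast_ofNat, hιnuinv, h7]
        ring

end Frame

/-! ## §2 ★★★ (K-2): the (S-D-★′) letter of zp v21 under F-P1′ + (CMT-ℤ) + the two period facts -/

set_option maxHeartbeats 4000000 in
open GenusSeven.ArithmeticInputs in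
/-- ★★★ **(K-2) — KATO'S 7-ADIC ★-VALUE LAW ON THE RECORD-FED FRAME, UNDER `∃ uStar`: the ∀-letter of the RESEARCH stub (S-D-★′)
`stub_katoExpUnitLawsSeven` of zp v21 (`Cruxes/EllipticUnitValueSevenOfGZK/Lines/kato_perrin_riou_zp.lean` bf8fc0bc14739463, l.891–929)
VERBATIM, derived from the four displayed named facts** `hFP1 : CM.kato15161_ellipticUnitClass_res_zetaFamily_free` (F-P1′, Kato (15.16.1)
with 15.14 / Thm. 12.5 (1) / §13.9–13.10 read after `⊗ ℚ`, p825229), `hCMT : CM.artin_natCast_smul_torsion` ((CMT-ℤ), p821859), `hMP :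
nonempty_modularParametrizationData` and `hLev : ∀ {N} [NeZero N], IsNewformOf.level_eq_conductorNorm` (the period clause (A5′) of the realised
family at the partner), by §1 at `Φ := katoGenusFrameOfRecord … D₃.toKummerColumnData d` (`subst`; the junctions `Φ.sqrtNegSeven = s`,
`Φ.𝔣 = (s)(|D|)`, `Φ.ψ = D₃.ψ`, `Φ.euK = D₃.euK`, `Φ.𝔏 = D₃.𝔏` are `rfl`, `Φ.IK = IK`, `Φ.Kcm = Kcm`, `Φ.φ = φ` definitionally).  Of the stub's
binders only `hγ, hR, s, hι₀, D₃, ι₇` and the frame are read; `hstar, hGZK, h25, hM1, hM1′, h155u, hC, hbad, e, 𝔞, z, hη, d` enter through `Φ`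
alone.  This theorem closes NO stub by itself: the pen's touch (11) keys `stub_katoExpUnitLawsSeven` to it inside zp, displaying the four facts.
[cite: Kato2004Asterisque, Thm. 12.5 (1) (p. 221), §13.9 (p. 230), Lemma 13.10 (1) (p. 230), Prop. 15.9 (15.9.1) (pp. 258–259), (15.12.1)–(15.12.2) (pp. 262–263), 15.14 (p. 264), (15.16.1) (p. 265)]
[cite: BlochKato1990, Def. 3.10 and Ex. 3.11 (pp. 359–361)] [cite: Washington1997, §13.1 and Prop. 13.2] -/
theorem katoExpUnitLawsSeven_of_FP1
    (hFP1 : CM.kato15161_ellipticUnitClass_res_zetaFamily_free) (hCMT : CM.artin_natCast_smul_torsion)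
    (hMP : nonempty_modularParametrizationData)
    (hLev : ∀ {N : ℕ} [NeZero N], IsNewformOf.level_eq_conductorNorm (N := N)) :
    ∀ (hstar : Kato2004.exists_zetaClassPosition_of_rank_le_one) (hGZK : rank_eq_analyticRank_of_analyticRank_le_one)
      (h25 : DeShalit1987.prop25_i_normRelation)
      (hM1 : CM.rayClassField_le_torsionField) (hM1' : CM.torsionField_le_rayClassField_of_conductor)
      (h155u : Kato2004.kato155_isUnit_of_two_le_primeDivisors)
      {W : WeierstrassCurve ℚ} [W.IsElliptic] [W.IsGloballyMinimal] [Fact (Nat.Prime 7)] (hC : X12.ClassCSeven W)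
      [ContinuousSMul ℤ_[7] (W.tateModule 7)] (K : ZpExtension ℚ 7) (hK : K.IsCyclotomic)
      {γ : Field.absoluteGaloisGroup ℚ} (hγ : K.IsTopGenerator γ) (I : IwasawaH1Data W 7 K γ)
      (hR : ∃ z₀ : I.H, Kato2004.IsAdmissibleZetaClass W 7 K hK I z₀)
      (F : GenusFrame) (hbad : ∀ (q : ℕ) [Fact q.Prime], q ≠ 7 → (¬ Good W q ↔ q ∣ F.d))
      (Kcm : Type) [Field Kcm] [NumberField Kcm] (h2 : Module.finrank ℚ Kcm = 2) (s : 𝓞 Kcm) (hs : (s : Kcm) ^ 2 = -7)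
      (ι₀ : Kcm →+* ℂ) (hι₀ : ∀ (w : InfinitePlace Kcm) (x : Kcm), ι₀ x = w.embedding x)
      (e : AlgebraicClosure Kcm →+* AlgebraicClosure ℚ)
      [ContinuousSMul ℤ_[7] ((W.baseChange Kcm).tateModule 7)]
      (γK : Field.absoluteGaloisGroup Kcm) (hγK : (K.restrictOfFinrankEqTwo (by decide) Kcm h2).IsTopGenerator γK)
      (IK : IwasawaH1DataOver (W.baseChange Kcm) 7 (K.restrictOfFinrankEqTwo (by decide) Kcm h2) γK)
      (φ : Isogeny (W.baseChange Kcm) (W.baseChange Kcm)) (hφ : ∀ P, φ (φ P) = (-7 : ℤ) • P)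
      (𝔞 : Ideal (𝓞 Kcm)) (h𝔞 : IsTwist 7 (Ideal.span {s} * Ideal.span {((F.d : ℕ) : 𝓞 Kcm)}) 𝔞)
      (hN𝔞 : Ideal.absNorm 𝔞 = F.normA) (z : ℕ → (AlgebraicClosure Kcm)ˣ)
      (hz : ∀ n : ℕ, IsKatoUnitRep 7 ι₀ (Ideal.span {s} * Ideal.span {((F.d : ℕ) : 𝓞 Kcm)}) (n + 1) 𝔞 (z n))
      (hη : ∀ (g₁ : geomTorsion (W.baseChange Kcm) ((7 : ℤ) ^ 1) →+ geomTorsion (W.baseChange Kcm) ((7 : ℤ) ^ 1)),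
        (∀ P, ((g₁ P : geomTorsion (W.baseChange Kcm) ((7 : ℤ) ^ 1)) : geomPoints (W.baseChange Kcm)) =
          φ (P : geomPoints (W.baseChange Kcm))) →
        ∀ (σ : Field.absoluteGaloisGroup Kcm) (a : ℕ) (ζ' : AlgebraicClosure Kcm), e ζ' = F.ζsys 0 → σ • ζ' = ζ' ^ a →
          ∀ P : geomTorsion (W.baseChange Kcm) ((7 : ℤ) ^ 1), g₁ P = 0 →
            σ • (P : geomPoints (W.baseChange Kcm)) =
              ((PadicInt.toZMod ((F.χD (a : ZMod F.d)) * (F.ω (a : ZMod 7)) ^ 5)).val : ℤ) • (P : geomPoints (W.baseChange Kcm)))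
      (D₃ : KummerColumnDataRat W Kcm h2 K IK ι₀ (Ideal.span {s} * Ideal.span {((F.d : ℕ) : 𝓞 Kcm)}) F.d φ)
      (d : GenusDatum F (normedFamilyOf F Kcm h2 s hs ι₀ e 𝔞 h𝔞 hN𝔞 z hz h155u))
      (ι₇ : ℚ_[7] →+* ℂ)
      (Φ : PinnedKatoGenusFrame W K hK I d),
      Φ = katoGenusFrameOfRecord hstar hGZK h25 hM1 hM1' h155u hC K hK hγ I F hbad Kcm h2 s hs ι₀ hι₀ e γK hγK IK φ hφ 𝔞 h𝔞 hN𝔞 z hz hη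
            D₃.toKummerColumnData d →
      ∃ (uStar : (IwasawaAlgebra 7)ˣ) (e' : ℕ) (α₀ α₁ : ℤ_[7]) (_ : α₀ ≠ 0 ∨ α₁ ≠ 0) (n₀ : ℕ),
        ∀ (n : ℕ), n₀ ≤ n → ∀ (χ : absoluteGaloisGroup Φ.Kcm →ₜ* ℂˣ),
          (∀ σ ∈ Φ.towerK.layerSubgroup (n + 1), χ σ = 1) →
          IsPrimitiveRoot (((χ Φ.γK : ℂˣ)) : ℂ) (7 ^ (n + 1)) →
          ∀ Lf : ℂ → ℂ, CM.IsDepletedHeckeL Φ.ψ χ (7 * (7 * F.d)) Lf →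
            (7 : ℂ) ^ e' * Φ.valOf ι₇ χ (uStar⁻¹ • I.resOver Φ.IK hγ Φ.isTopGenerator_γK Φ.zOne) =
              (ι₇ (α₀ : ℚ_[7]) + ι₇ (α₁ : ℚ_[7]) * Φ.ιC (algebraMap Φ.Kcm (AlgebraicClosure Φ.Kcm) Φ.sqrtNegSeven)) * Φ.Ω⁻¹ * Lf 1 := by
  intro hstar hGZK h25 hM1 hM1' h155u W _ _ _ hC _ K hK γ hγ I hR F hbad Kcm _ _ h2 s hs ι₀ hι₀ e _ γK hγK IK φ hφ 𝔞 h𝔞 hN𝔞 z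
    hz hη D₃ d ι₇ Φ hΦ
  subst hΦ
  exact PinnedKatoGenusFrame.unitLaws_of_FP1 hFP1 hCMT hMP hLev hγ hR _ s rfl rfl ι₀ hι₀ D₃ rfl rfl rfl ι₇

end Summit.BirchSwinnertonDyer.Rank1Residual.Additive.GenusSeven

end
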